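import Summits.ValiantsHypothesis.ValiantsHypothesis.Theorems.NisanPermanent
import HarnessLib

/-!
# OrderedCountWindow — the support-size dial of sums of ORDERED set-multilinear ABPs for `per`
(decomposition workshop `decomp-valiant`, lens 6 «restricted-models lifting axis», gen 6; a typed
SIBLING DIAL POINT under `DecompCycle1.PerNotSmVP` = stmt-ValiantsHypothesis-23661, with a rung DECIDED
IN KERNEL AT A GROWING PARAMETER; companions `OrderedCountWindowRungs` (the dial `A_t` and its rungs)
and `OrderedCountWindowNecessity` (`VP ≠ VNP → A_t` for every `t`))

## The dial

An ORDERED set-multilinear ABP for `per_n` (block = column; Arvind–Raja's "ROABP in the set-multilinear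
setting", Chatterjee–Kush–Saraf–Shpilka's "smABP in some order `σ`") reads, in position `p`, one
variable of column `σ p`; its transfer matrices give the COEFFICIENT TENSOR `B : (Fin n → Fin n) → F`
of the words of rows read (`B` has nc-ABP width `≤ w`, tree `BDI2020.HasNcABPWidthLE`), and the
coefficient of `∏_c X_(J c, c)` (`J` = column ↦ row) is `B (J ∘ σ)`.  A SUM of `t` such programs in `t`
possibly different orders computes `per_n` iff `∑_i B_i (J ∘ σ_i) = perWord J` (Nisan's word tensor of
the ordered permanent, `Theorems.NisanPermanent.perWord`) for every `J`: `IsSumOrdered F n t W`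
(`W` = total width).  `t = 1` is one noncommutative ABP (width exactly `C(n,⌊n/2⌋)`, the gen-4 rung);
`t = poly(n)` in arbitrary orders is, up to polynomial simulation, the full set-multilinear ABP, whose
super-polynomial lower bound for `per` is OPEN [cite: ChatterjeeKushSarafShpilka2024, §1.2].

## This file: the DECIDED RUNG, uniform in the orders (kernel)

`two_pow_le_of_isSumOrdered`: every sum of `t` ordered programs computing `per_n` has total width
`≥ 2^{⌊⌊n/2⌋/t⌋}` — Arvind–Raja's partition-and-rank argument [cite: ArvindRaja2016, Thm 7, Thm 9, Cor 12]
("total width `2^{Ω(n/t)}` … `t` must be sub-linear" [cite: ChatterjeeKushSarafShpilka2024, §1.2])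
made explicit: take the last `r = ⌊⌊n/2⌋/t⌋` positions of every program, let `Z` (`ν ≤ t r ≤ n/2`
columns) be the union of the columns read there and `Y` a set of `ν` further columns; on the
`2^ν × 2^ν` family of TEST WORDS that swap or fix each pair `(y_j, z_j)` the permanent tensor is the
IDENTITY matrix, while program `i` contributes a matrix of rank `≤ 2^{ν-r} w_i` (its last `r`
positions read only `Z`-columns: factor through Nisan's cut, `BDI2020.Nisan.wordFlattening_eq_mul`).
Hence `2^ν ≤ 2^{ν-r} ∑ w_i`.  Nothing here proves `VP ≠ VNP`; the bound holds verbatim for `det`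
(same word tensor up to signs), so this rung alone does not separate `per` from `det`.

[cite: ArvindRaja2016, Thm 7, Thm 9, Cor 12] [cite: ChatterjeeKushSarafShpilka2024, §1.2]
[cite: Nisan1991Noncommutative, §4]
-/

noncomputable section

namespace Summit.ValiantsHypothesis.ValiantsHypothesis.Theorems.OrderedCountWindow

open Literature.Computability.AlgebraicComplexity Matrix

/-! ## §1 Sums of ordered set-multilinear ABPs (coefficient-tensor form) -/

/-- **`per_n` is a sum of `t` ORDERED set-multilinear ABPs of total width `≤ W` over `F`**: there are
block orders `σ i : Fin n ≃ Fin n` (position ↦ column), widths `w i` with `∑ w i ≤ W`, and coefficient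
tensors `B i` (word of rows ↦ coefficient) of nc-ABP width `≤ w i`, such that for every assignment
`J : column ↦ row` the coefficients of `∏_c X_(J c, c)` add up to Nisan's `perWord J`
(`= 1` if `J` is a permutation, `0` otherwise). [cite: ArvindRaja2016, §3 (ROABPs), Thm 7] -/
def IsSumOrdered (F : Type*) [Field F] (n t W : ℕ) : Prop :=
  ∃ (σ : Fin t → Equiv.Perm (Fin n)) (w : Fin t → ℕ) (B : Fin t → (Fin n → Fin n) → F),
    (∀ i, BDI2020.HasNcABPWidthLE (w i) (B i)) ∧ ∑ i, w i ≤ W ∧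
      ∀ J : Fin n → Fin n, ∑ i, B i (J ∘ ⇑(σ i)) = NisanPermanent.perWord F n J

variable {F : Type*} [Field F]

/-- Monotonicity in the budget. [folklore] -/
theorem IsSumOrdered.mono {n t W W' : ℕ} (h : IsSumOrdered F n t W) (hW : W ≤ W') :
    IsSumOrdered F n t W' := by
  obtain ⟨σ, w, B, hB, hsum, hper⟩ := h
  exact ⟨σ, w, B, hB, hsum.trans hW, hper⟩

/-- No sum of `0` programs computes `per_n` (`perWord id = 1 ≠ 0`). [folklore] -/
theorem IsSumOrdered.pos {n t W : ℕ} (h : IsSumOrdered F n t W) : 0 < t := by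
  obtain ⟨σ, w, B, hB, hsum, hper⟩ := h
  rcases Nat.eq_zero_or_pos t with rfl | ht
  · have := hper id
    simp [NisanPermanent.perWord, Function.injective_id] at this
  · exact ht

/-! ## §2 Rank bookkeeping -/

section Rank

variable {m m' : Type*} [Fintype m']

/-- `rank (A + B) ≤ rank A + rank B`. [folklore] -/
theorem rank_add_le (A B : Matrix m m' F) : (A + B).rank ≤ A.rank + B.rank := by
  unfold Matrix.rank
  rw [Matrix.mulVecLin_add]
  exact (Submodule.finrank_mono (LinearMap.range_add_le _ _)).trans
    (Submodule.finrank_add_le_finrank_add_finrank _ _)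

/-- `rank (∑ Aᵢ) ≤ ∑ rank Aᵢ`. [folklore] -/
theorem rank_sum_le {ι : Type*} (s : Finset ι) (A : ι → Matrix m m' F) :
    (∑ i ∈ s, A i).rank ≤ ∑ i ∈ s, (A i).rank := by
  classical
  induction s using Finset.induction_on with
  | empty => simp
  | insert a s ha ih =>
    rw [Finset.sum_insert ha, Finset.sum_insert ha]
    exact (rank_add_le _ _).trans (Nat.add_le_add_left ih _)

end Rank

/-! ## §3 The test words: swap or fix the pairs `(y j, z j)` -/

section TestWord

variable {n ν : ℕ} (y z : Fin ν → Fin n)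

/-- The TEST WORD `J_(εY, εZ) : column ↦ row` attached to two disjoint injective enumerations `y, z` of
columns and two bit vectors: column `y j` is sent to `z j` if `εY j` (else fixed), column `z j` to
`y j` if `εZ j` (else fixed), every other column is fixed.  It is a permutation iff `εY = εZ`.
[cite: ArvindRaja2016, Thm 7 (proof)] -/
def testWord (εY εZ : Fin ν → Bool) (c : Fin n) : Fin n :=
  if h : ∃ j, y j = c then (if εY h.choose then z h.choose else c)
  else if h' : ∃ j, z j = c then (if εZ h'.choose then y h'.choose else c)
  else c

variable {y z}

/-- Value on a `y`-column. [folklore] -/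
theorem testWord_y (hy : Function.Injective y) (εY εZ : Fin ν → Bool) (j : Fin ν) :
    testWord y z εY εZ (y j) = if εY j then z j else y j := by
  have h : ∃ j', y j' = y j := ⟨j, rfl⟩
  have hj : h.choose = j := hy h.choose_spec
  unfold testWord
  rw [dif_pos h, hj]

/-- Value on a `z`-column. [folklore] -/
theorem testWord_z (hz : Function.Injective z) (hyz : ∀ j j', y j ≠ z j') (εY εZ : Fin ν → Bool)
    (j : Fin ν) : testWord y z εY εZ (z j) = if εZ j then y j else z j := by
  have h : ¬ ∃ j', y j' = z j := fun ⟨j', e⟩ => hyz j' j e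
  have h' : ∃ j', z j' = z j := ⟨j, rfl⟩
  have hj : h'.choose = j := hz h'.choose_spec
  unfold testWord
  rw [dif_neg h, dif_pos h', hj]

/-- Value on every other column. [folklore] -/
theorem testWord_other (εY εZ : Fin ν → Bool) {c : Fin n} (h : ∀ j, y j ≠ c) (h' : ∀ j, z j ≠ c) :
    testWord y z εY εZ c = c := by
  unfold testWord
  rw [dif_neg (fun ⟨j, e⟩ => h j e), dif_neg (fun ⟨j, e⟩ => h' j e)]

/-- **The test word is a permutation iff the two bit vectors agree.** [cite: ArvindRaja2016, Thm 7 (proof)] -/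
theorem testWord_injective_iff (hy : Function.Injective y) (hz : Function.Injective z)
    (hyz : ∀ j j', y j ≠ z j') (εY εZ : Fin ν → Bool) :
    Function.Injective (testWord y z εY εZ) ↔ εY = εZ := by
  constructor
  · intro hinj
    funext j
    by_contra hj
    have h1 := testWord_y (z := z) hy εY εZ j
    have h2 := testWord_z hz hyz εY εZ j
    have hne : y j ≠ z j := hyz j j
    cases hY : εY j <;> cases hZ : εZ j
    · exact hj (hY.trans hZ.symm)
    · rw [hY] at h1
      rw [hZ] at h2
      simp only [Bool.false_eq_true, if_false, if_true] at h1 h2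
      exact hne (hinj (h1.trans h2.symm))
    · rw [hY] at h1
      rw [hZ] at h2
      simp only [Bool.false_eq_true, if_false, if_true] at h1 h2
      exact hne (hinj (h1.trans h2.symm))
    · exact hj (hY.trans hZ.symm)
  · rintro rfl
    have hinv : Function.Involutive (testWord y z εY εY) := by
      intro c
      by_cases hc : ∃ j, y j = c
      · obtain ⟨j, rfl⟩ := hc
        cases hε : εY j <;> simp [testWord_y hy, testWord_z hz hyz, hε]
      · by_cases hc' : ∃ j, z j = c
        · obtain ⟨j, rfl⟩ := hc'
          cases hε : εY j <;> simp [testWord_y hy, testWord_z hz hyz, hε]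
        · push Not at hc hc'
          rw [testWord_other _ _ hc hc', testWord_other _ _ hc hc']
    exact hinv.injective

/-- Off the `z`-columns indexed by `T`, the test word does not see the bits `εZ |_T`. [folklore] -/
theorem testWord_congr (hy : Function.Injective y) (hz : Function.Injective z)
    (hyz : ∀ j j', y j ≠ z j') {T : Finset (Fin ν)} {εY εZ εZ' : Fin ν → Bool}
    (hε : ∀ j, j ∉ T → εZ j = εZ' j) {c : Fin n} (hc : ∀ j ∈ T, z j ≠ c) :
    testWord y z εY εZ c = testWord y z εY εZ' c := by
  by_cases h1 : ∃ j, y j = c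
  · obtain ⟨j, rfl⟩ := h1
    rw [testWord_y hy, testWord_y hy]
  · by_cases h2 : ∃ j, z j = c
    · obtain ⟨j, rfl⟩ := h2
      have hj : j ∉ T := fun hjT => hc j hjT rfl
      rw [testWord_z hz hyz, testWord_z hz hyz, hε j hj]
    · push Not at h1 h2
      rw [testWord_other _ _ h1 h2, testWord_other _ _ h1 h2]

end TestWord

/-! ## §4 One program: rank through Nisan's cut -/

/-- **Rank of one ordered program on a test family.** If the row index enters only the prefix word
(first `a` positions) and the column index enters the suffix word (last `r` positions) and the prefix
word only through the bits OUTSIDE `T`, then the matrix `(εY, εZ) ↦ Ψ(prefix ++ suffix)` of a tensor of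
nc-ABP width `≤ w` has rank `≤ 2^{|Tᶜ|} · w` (factor through the cut `a | r`,
`BDI2020.Nisan.wordFlattening_eq_mul`, and through the `2^{|Tᶜ|}` values of the shared bits).
[cite: ArvindRaja2016, Thm 7 (proof)] -/
theorem rank_le_of_prefix_suffix {a r m w ν : ℕ} {Ψ : (Fin (a + r) → Fin m) → F}
    (hΨ : BDI2020.HasNcABPWidthLE w Ψ) (T : Finset (Fin ν))
    (pre : (Fin ν → Bool) → (Fin ν → Bool) → Fin a → Fin m) (suf : (Fin ν → Bool) → Fin r → Fin m)
    (hpre : ∀ εY εZ εZ', (∀ j, j ∉ T → εZ j = εZ' j) → pre εY εZ = pre εY εZ') :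
    (Matrix.of fun εY εZ => Ψ (Fin.append (pre εY εZ) (suf εZ))).rank ≤ 2 ^ Tᶜ.card * w := by
  classical
  obtain ⟨C, u, v, hC⟩ := hΨ
  have hflat := BDI2020.Nisan.wordFlattening_eq_mul (a := a) (b := r) C u v Ψ hC
  set Rm : Matrix (Fin a → Fin m) (Fin w) F := Matrix.of fun p : Fin a → Fin m =>
      u ᵥ* (List.ofFn fun t : Fin a => C (Fin.castLE (Nat.le_add_right a r) t) (p t)).prod with hRm
  set Cm : Matrix (Fin w) (Fin r → Fin m) F := Matrix.of fun (k : Fin w) (s : Fin r → Fin m) =>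
      ((List.ofFn fun t : Fin r => C (Fin.natAdd a t) (s t)).prod *ᵥ v) k with hCm
  -- extension / restriction of the column bits along `Tᶜ`
  let ext : (↥(Tᶜ) → Bool) → Fin ν → Bool := fun α j => if h : j ∈ Tᶜ then α ⟨j, h⟩ else false
  let res : (Fin ν → Bool) → ↥(Tᶜ) → Bool := fun εZ j => εZ j
  have hext : ∀ εZ j, j ∉ T → ext (res εZ) j = εZ j := by
    intro εZ j hj
    have hj' : j ∈ Tᶜ := Finset.mem_compl.2 hj
    simp only [ext, res]
    rw [dif_pos hj']
  let Rbig : Matrix (Fin ν → Bool) ((↥(Tᶜ) → Bool) × Fin w) F :=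
    Matrix.of fun εY αk => Rm (pre εY (ext αk.1)) αk.2
  let Cbig : Matrix ((↥(Tᶜ) → Bool) × Fin w) (Fin ν → Bool) F :=
    Matrix.of fun αk εZ => if res εZ = αk.1 then Cm αk.2 (suf εZ) else 0
  have hM : (Matrix.of fun εY εZ => Ψ (Fin.append (pre εY εZ) (suf εZ))) = Rbig * Cbig := by
    ext εY εZ
    have h1 : Ψ (Fin.append (pre εY εZ) (suf εZ)) = (Rm * Cm) (pre εY εZ) (suf εZ) := by
      rw [← hflat, wordFlattening_apply]
      rfl
    rw [Matrix.of_apply, h1, Matrix.mul_apply, Matrix.mul_apply, Fintype.sum_prod_type,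
      Finset.sum_eq_single (res εZ)]
    · simp only [Rbig, Cbig, Matrix.of_apply, if_true]
      rw [hpre εY (ext (res εZ)) εZ (fun j hj => hext εZ j hj)]
    · intro α _ hα
      simp [Rbig, Cbig, Ne.symm hα]
    · intro h
      exact absurd (Finset.mem_univ _) h
  rw [hM]
  refine (Matrix.rank_mul_le_left _ _).trans ((Matrix.rank_le_card_width _).trans (le_of_eq ?_))
  simp only [Fintype.card_prod, Fintype.card_pi, Fintype.card_bool, Finset.prod_const,
    Finset.card_univ, Fintype.card_coe, Fintype.card_fin]

/-! ## §5 The kernel lower bound -/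

/-- Core of the partition-and-rank argument at the cut `a | r` (`n = a + r`): if `2 t r ≤ n` then a sum
of `t` ordered programs for `per_n` has total width `≥ 2^r`. [cite: ArvindRaja2016, Thm 7, Thm 9 (proof)] -/
theorem two_pow_le_sum_width {a r t : ℕ} (σ : Fin t → Equiv.Perm (Fin (a + r))) (w : Fin t → ℕ)
    (B : Fin t → (Fin (a + r) → Fin (a + r)) → F)
    (hB : ∀ i, BDI2020.HasNcABPWidthLE (w i) (B i))
    (hper : ∀ J, ∑ i, B i (J ∘ ⇑(σ i)) = NisanPermanent.perWord F (a + r) J)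
    (ht : 0 < t) (hroom : 2 * (t * r) ≤ a + r) : 2 ^ r ≤ ∑ i, w i := by
  classical
  -- the columns read in the last `r` positions of program `i`
  let L : Fin t → Finset (Fin (a + r)) := fun i =>
    Finset.univ.image fun s : Fin r => σ i (Fin.natAdd a s)
  have hLinj : ∀ i, Function.Injective fun s : Fin r => σ i (Fin.natAdd a s) := by
    intro i s s' h
    have h' : Fin.natAdd a s = Fin.natAdd a s' := (σ i).injective h
    simpa [Fin.ext_iff] using h'
  have hLcard : ∀ i, (L i).card = r := fun i => by
    simp only [L, Finset.card_image_of_injective _ (hLinj i), Finset.card_univ, Fintype.card_fin]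
  have hmemL : ∀ i (s : Fin r), σ i (Fin.natAdd a s) ∈ L i := fun i s =>
    Finset.mem_image_of_mem (fun s : Fin r => σ i (Fin.natAdd a s)) (Finset.mem_univ s)
  let U : Finset (Fin (a + r)) := Finset.univ.biUnion L
  have hLU : ∀ i, L i ⊆ U := fun i => Finset.subset_biUnion_of_mem L (Finset.mem_univ i)
  have hU : U.card ≤ t * r :=
    Finset.card_biUnion_le.trans (by simp [hLcard])
  have hrU : r ≤ U.card := (hLcard ⟨0, ht⟩).symm.le.trans (Finset.card_le_card (hLU _))
  -- enumerate `Z = U` and a set `Y` of `|U|` columns outside `U`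
  let z : Fin U.card → Fin (a + r) := fun j => U.orderEmbOfFin rfl j
  have hzU : ∀ j, z j ∈ U := fun j => Finset.orderEmbOfFin_mem U rfl j
  have hz : Function.Injective z := (U.orderEmbOfFin rfl).injective
  have hUz : ∀ c ∈ U, ∃ j, z j = c := by
    intro c hc
    have : c ∈ Set.range (U.orderEmbOfFin rfl) := by rw [Finset.range_orderEmbOfFin]; exact hc
    exact this
  have hcompl : U.card ≤ Uᶜ.card := by rw [Finset.card_compl, Fintype.card_fin]; omega
  let y : Fin U.card → Fin (a + r) := fun j => Uᶜ.orderEmbOfFin rfl (Fin.castLE hcompl j)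
  have hyU : ∀ j, y j ∉ U := fun j => Finset.mem_compl.1 (Finset.orderEmbOfFin_mem Uᶜ rfl _)
  have hy : Function.Injective y :=
    (Uᶜ.orderEmbOfFin rfl).injective.comp (Fin.castLE_injective hcompl)
  have hyz : ∀ j j', y j ≠ z j' := fun j j' h => hyU j (h ▸ hzU j')
  -- the index set of the suffix columns of program `i` inside `Z`
  let T : Fin t → Finset (Fin U.card) := fun i => Finset.univ.filter fun j => z j ∈ L i
  have hTcard : ∀ i, (T i).card = r := by
    intro i
    have himg : (T i).image z = L i := by
      ext c
      simp only [Finset.mem_image, T, Finset.mem_filter, Finset.mem_univ, true_and]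
      constructor
      · rintro ⟨j, hj, rfl⟩
        exact hj
      · intro hc
        obtain ⟨j, rfl⟩ := hUz c (hLU i hc)
        exact ⟨j, hc, rfl⟩
    calc (T i).card = ((T i).image z).card := (Finset.card_image_of_injective _ hz).symm
      _ = (L i).card := by rw [himg]
      _ = r := hLcard i
  have hTcompl : ∀ i, (T i)ᶜ.card = U.card - r := fun i => by
    rw [Finset.card_compl, Fintype.card_fin, hTcard]
  -- the test matrices
  let P : Matrix (Fin U.card → Bool) (Fin U.card → Bool) F :=
    Matrix.of fun εY εZ => NisanPermanent.perWord F (a + r) (testWord y z εY εZ)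
  let M : Fin t → Matrix (Fin U.card → Bool) (Fin U.card → Bool) F := fun i =>
    Matrix.of fun εY εZ => B i (testWord y z εY εZ ∘ ⇑(σ i))
  have hP1 : P = 1 := by
    ext εY εZ
    by_cases h : εY = εZ
    · subst h
      simp [P, NisanPermanent.perWord, testWord_injective_iff hy hz hyz]
    · simp [P, NisanPermanent.perWord, testWord_injective_iff hy hz hyz, h]
  have hPM : P = ∑ i, M i := by
    ext εY εZ
    simp only [P, M, Matrix.of_apply, Matrix.sum_apply]
    exact (hper _).symm
  -- rank of one program
  have hMrank : ∀ i, (M i).rank ≤ 2 ^ (U.card - r) * w i := by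
    intro i
    let pre : (Fin U.card → Bool) → (Fin U.card → Bool) → Fin a → Fin (a + r) :=
      fun εY εZ p => testWord y z εY εZ (σ i (Fin.castAdd r p))
    let suf : (Fin U.card → Bool) → Fin r → Fin (a + r) :=
      fun εZ s => testWord y z (fun _ => false) εZ (σ i (Fin.natAdd a s))
    have hsuf : ∀ εY εZ (s : Fin r), testWord y z εY εZ (σ i (Fin.natAdd a s)) = suf εZ s := by
      intro εY εZ s
      obtain ⟨j, hj⟩ := hUz _ (hLU i (hmemL i s))
      dsimp only [suf]
      rw [← hj, testWord_z hz hyz, testWord_z hz hyz]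
    have hword : ∀ εY εZ, testWord y z εY εZ ∘ ⇑(σ i) = Fin.append (pre εY εZ) (suf εZ) := by
      intro εY εZ
      refine funext fun p => Fin.addCases
        (motive := fun p => (testWord y z εY εZ ∘ ⇑(σ i)) p = Fin.append (pre εY εZ) (suf εZ) p)
        (fun p' => ?_) (fun s => ?_) p
      · simp only [Function.comp_apply, Fin.append_left]
        rfl
      · simp only [Function.comp_apply, Fin.append_right]
        exact hsuf εY εZ s
    have hMi : M i = Matrix.of fun εY εZ => B i (Fin.append (pre εY εZ) (suf εZ)) := by
      ext εY εZ
      simp only [M, Matrix.of_apply, hword]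
    have hpre : ∀ εY εZ εZ', (∀ j, j ∉ T i → εZ j = εZ' j) → pre εY εZ = pre εY εZ' := by
      intro εY εZ εZ' hε
      funext p
      dsimp only [pre]
      refine testWord_congr hy hz hyz hε fun j hj hc => ?_
      have hjL : z j ∈ L i := (Finset.mem_filter.1 hj).2
      obtain ⟨s, -, hs⟩ := Finset.mem_image.1 hjL
      have h' : Fin.natAdd a s = Fin.castAdd r p := (σ i).injective (hs.trans hc)
      have h'' := congrArg Fin.val h'
      have hp := p.isLt
      simp only [Fin.val_natAdd, Fin.val_castAdd] at h''
      omega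
    rw [hMi, ← hTcompl i]
    exact rank_le_of_prefix_suffix (hB i) (T i) pre suf hpre
  -- assemble: `2^ν = rank 1 = rank (∑ Mᵢ) ≤ ∑ rank Mᵢ ≤ 2^(ν - r) ∑ wᵢ`
  have hrank : Fintype.card (Fin U.card → Bool) ≤ 2 ^ (U.card - r) * ∑ i, w i := by
    calc Fintype.card (Fin U.card → Bool) = P.rank := by rw [hP1, Matrix.rank_one]
      _ = (∑ i, M i).rank := by rw [hPM]
      _ ≤ ∑ i, (M i).rank := rank_sum_le _ _
      _ ≤ ∑ i, 2 ^ (U.card - r) * w i := Finset.sum_le_sum fun i _ => hMrank i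
      _ = 2 ^ (U.card - r) * ∑ i, w i := by rw [Finset.mul_sum]
  have hcard : Fintype.card (Fin U.card → Bool) = 2 ^ (U.card - r) * 2 ^ r := by
    rw [← pow_add, Nat.sub_add_cancel hrU]
    simp
  rw [hcard] at hrank
  exact Nat.le_of_mul_le_mul_left hrank (by positivity)

/-- **THE DECIDED RUNG (kernel; Arvind–Raja for every support size, explicit constant).** A sum of `t`
ordered set-multilinear ABPs computing `per_n`, in ANY block orders, has total width at least
`2^{⌊⌊n/2⌋/t⌋}`. [cite: ArvindRaja2016, Thm 7, Thm 9, Cor 12] -/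
theorem two_pow_le_of_isSumOrdered {n t W : ℕ} (h : IsSumOrdered F n t W) :
    2 ^ (n / 2 / t) ≤ W := by
  have ht : 0 < t := h.pos
  obtain ⟨σ, w, B, hB, hsum, hper⟩ := h
  refine le_trans ?_ hsum
  generalize hr : n / 2 / t = r
  have hrn : r ≤ n := by
    rw [← hr]
    exact (Nat.div_le_self _ _).trans (Nat.div_le_self _ _)
  have hroom : 2 * (t * r) ≤ n := by
    rw [← hr]
    calc 2 * (t * (n / 2 / t)) ≤ 2 * (n / 2) := Nat.mul_le_mul_left 2 (Nat.mul_div_le (n / 2) t)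
      _ ≤ n := Nat.mul_div_le n 2
  obtain ⟨a, rfl⟩ : ∃ a, a + r = n := ⟨n - r, Nat.sub_add_cancel hrn⟩
  exact two_pow_le_sum_width σ w B hB hper ht hroom

/-- In particular the total width is positive. [folklore] -/
theorem one_le_of_isSumOrdered {n t W : ℕ} (h : IsSumOrdered F n t W) : 1 ≤ W :=
  le_trans Nat.one_le_two_pow (two_pow_le_of_isSumOrdered h)

end Summit.ValiantsHypothesis.ValiantsHypothesis.Theorems.OrderedCountWindow
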